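import Summits.Ventures.GridStability.Lyapunov.RelativeLffClosedFormLines
import Summits.Ventures.GridStability.Models.SwingTubeChain
import HarnessLib

/-!
# GridStability/Lyapunov/RelativeLffLevelTest — a DECIDABLE «K ⊂ S» test for the closed-form LFF level sets

Venture GRIDFUSION (LADDER-GRIDFUSION G1-cct next wave «G1cct-NE39L-LOWER-K»; seat gridfusion-model-1 g8).  GENERIC in `d : RecastData n`.
The explicit-level rows of the LFF lane (lyap-1 `RelativeLffClosedFormLines` p493112 / `NE39LLffLevel` p493380: for every
`c₀ < (2/λ + λ/2)·L` the set `{y ∈ 𝒫 | V_λ y ≤ c₀}` of the closed-form certificate `certU` is a region of attraction / synchronisation)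
are CONSUMED by a box test: given certified node tables `lo ≤ θ* ≤ hi` and a box of machine states `S : SwingTube.SliceBox (n+1)`
(relative rotor angles `a_i = δ_i − δ_0 ∈ [alo, ahi]`, speeds `ω_i ∈ [wlo, whi]` — the output of the kernel fault-on tubes,
`SwingTube.clearingState_of_chainOK`), ONE rational `VhiQ d λ lo hi S` bounds `V_λ` on the box from above and ONE Bool `polyOKQ` certifies
the polytope condition.  §1 data over `ℚ` (`StotQ`, `NinvQ` = lyap-1's Sherman–Morrison `Ninv`, `QblkQ λ` = the block matrix
`[[λN⁻¹, N⁻¹], [N⁻¹, (2/λ+λ/2)N⁻¹]]`, which IS `certU`'s `Q` — `certU_Q_cast`); §2 `certU_V_eq`: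
`V_λ(lffState θ* x) = ½ yᵀQy − (2/λ+λ/2)·Σ_{i<j} C_ij (cos(a_i − a_j) + (a_i − a_j)·sd_ij)` with the EXACT `sd_ij = sin(θ*_i − θ*_j)`;
§3 `quadBoxQ` / `quad_le_quadBoxQ` (any matrix, centre/radius bound `cᵀAc + Σ_p (|(Ac)_p| + |(Aᵀc)_p|) r_p + Σ_pq |A_pq| r_p r_q`);
§4 the test (`VhiQ = quadBoxQ/2 + potHiQ`, line terms by model-1's `SwingTube.cosRLo_le` and the sign-free product bound; `boxOKQ`,
`polyOKQ`) and its SOUNDNESS `certU_V_le_VhiQ`, `lffState_mem_polytope_of_polyOKQ`.  THREE COLUMNS: theorem schema about MODEL M′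
(lossless network-reduced classical model, uniform damping λ; MV-2L + MV-λ, + MV-RD/MV-h12 per instance); CERTIFIED per instance = finitely
many rational inequalities; VALIDATED nothing.  No sentence here says that any grid is stable.  Definitions = rational bookkeeping only;
no named fact; standard axioms.  [cite: VuTuritsyn2016, §III eq. (Lyapunov), §IV set ℛ; Moore1979, §8.1 eq. (8.10)]
-/

noncomputable section

open Set Real Matrix Finset Literature.MathematicalPhysics.PowerSystems
open Literature.MathematicalPhysics.PowerSystems.LyapunovFunctionFamily
open Summit.Ventures.GridStability.Models Summit.Ventures.GridStability.Models.AngleEnclosure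

namespace Summit.Ventures.GridStability.Lyapunov.RelativeLff

variable {n : ℕ} (d : RecastData n)

/-! ### §1 The closed-form certificate's matrix over `ℚ` -/

/-- Total inertia over `ℚ`: `S = M_0 + Σ_m M_{m+1}`. -/
def StotQ : ℚ := d.M 0 + ∑ m : Fin n, d.M m.succ

/-- `StotQ` casts to lyap-1's `S d`. -/
theorem SQ_cast : ((StotQ d : ℚ) : ℝ) = S d := by
  simp only [StotQ, S, Mref, Mμ]
  push_cast
  rfl

/-- Sherman–Morrison inverse over `ℚ`: `N⁻¹_ik = [i = k]·M_{i+1} − M_{i+1}M_{k+1}/S`. -/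
def NinvQ (i k : Fin n) : ℚ := (if i = k then d.M i.succ else 0) - 1 / StotQ d * (d.M i.succ * d.M k.succ)

/-- `NinvQ` casts to lyap-1's `Ninv d`. -/
theorem NinvQ_cast (i k : Fin n) : ((NinvQ d i k : ℚ) : ℝ) = Ninv d i k := by
  rw [Ninv_apply]
  by_cases h : i = k
  · simp only [NinvQ, h, if_true, Mμ, Rat.cast_sub, Rat.cast_mul, Rat.cast_div, Rat.cast_one, SQ_cast]
  · simp only [NinvQ, h, if_false, Mμ, Rat.cast_sub, Rat.cast_mul, Rat.cast_div, Rat.cast_one, Rat.cast_zero,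
      SQ_cast]

/-- The matrix `Q` of the closed-form certificate over `ℚ`: `[[λN⁻¹, N⁻¹], [N⁻¹, (2/λ + λ/2)N⁻¹]]`. -/
def QblkQ (lam : ℚ) : Fin n ⊕ Fin n → Fin n ⊕ Fin n → ℚ
  | Sum.inl i, Sum.inl k => lam * NinvQ d i k
  | Sum.inl i, Sum.inr k => NinvQ d i k
  | Sum.inr i, Sum.inl k => NinvQ d k i
  | Sum.inr i, Sum.inr k => (2 / lam + lam / 2) * NinvQ d i k

/-- The closed form's `Q` is the block matrix (definitional). -/
theorem certU_Q_eq (lam : ℚ) (hlam : 0 < lam) (δs : Fin (n + 1) → ℝ) {ν : ℝ} (hν : 0 < ν)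
    (hM : ∀ i, 0 < d.M i) (hνM : ∀ m, ν < Mμ d m) (hCS : ∑ m, Mμ d m ^ 2 / (Mμ d m - ν) ≤ S d)
    (hC : ∀ i j : Fin (n + 1), i ≠ j → 0 < d.Cc i j) :
    (certU d lam hlam δs hν hM hνM hCS hC).Q =
      Matrix.fromBlocks (((lam : ℝ) * 1) • Ninv d) ((1 : ℝ) • Ninv d) (((1 : ℝ) • Ninv d)ᵀ)
        ((2 / (lam : ℝ) + (lam : ℝ) / 2) • Ninv d) := rfl

/-- **Entries of the closed form's `Q` are the rationals `QblkQ`.** -/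
theorem certU_Q_cast (lam : ℚ) (hlam : 0 < lam) (δs : Fin (n + 1) → ℝ) {ν : ℝ} (hν : 0 < ν)
    (hM : ∀ i, 0 < d.M i) (hνM : ∀ m, ν < Mμ d m) (hCS : ∑ m, Mμ d m ^ 2 / (Mμ d m - ν) ≤ S d)
    (hC : ∀ i j : Fin (n + 1), i ≠ j → 0 < d.Cc i j) (p q : Fin n ⊕ Fin n) :
    (certU d lam hlam δs hν hM hνM hCS hC).Q p q = ((QblkQ d lam p q : ℚ) : ℝ) := by
  rw [certU_Q_eq]
  rcases p with i | i <;> rcases q with k | k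
  · simp only [Matrix.fromBlocks_apply₁₁, Matrix.smul_apply, smul_eq_mul, QblkQ, ← NinvQ_cast]
    push_cast; ring
  · simp only [Matrix.fromBlocks_apply₁₂, Matrix.smul_apply, smul_eq_mul, QblkQ, ← NinvQ_cast]
    ring
  · simp only [Matrix.fromBlocks_apply₂₁, Matrix.transpose_apply, Matrix.smul_apply, smul_eq_mul, QblkQ, ← NinvQ_cast]
    ring
  · simp only [Matrix.fromBlocks_apply₂₂, Matrix.smul_apply, smul_eq_mul, QblkQ, ← NinvQ_cast]
    push_cast; ring

/-- The closed form's `K_k = (2/λ + λ/2)·C_ij` (definitional). -/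
theorem certU_kK (lam : ℚ) (hlam : 0 < lam) (δs : Fin (n + 1) → ℝ) {ν : ℝ} (hν : 0 < ν)
    (hM : ∀ i, 0 < d.M i) (hνM : ∀ m, ν < Mμ d m) (hCS : ∑ m, Mμ d m ^ 2 / (Mμ d m - ν) ≤ S d)
    (hC : ∀ i j : Fin (n + 1), i ≠ j → 0 < d.Cc i j) (k : RecastData.LffLine n) :
    (certU d lam hlam δs hν hM hνM hCS hC).kK k = (2 / (lam : ℝ) + (lam : ℝ) / 2) * (d.Cc k.1.1 k.1.2 : ℝ) := rfl

/-! ### §2 The value of `V_λ` on a machine state -/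

/-- Relative rotor angle `a_i = δ_i − δ_0` of a machine state. -/
def relAngle (x : ClassicalSwing.State (n + 1)) (i : Fin (n + 1)) : ℝ := x.1 i - x.1 0

/-- The line angle of the LFF system at `lffState θ* x` on line `(i, j)` is `a_i − a_j`. -/
theorem lineAngle_lffState (lam : ℚ) (δs : Fin (n + 1) → ℝ) (x : ClassicalSwing.State (n + 1))
    (k : RecastData.LffLine n) :
    (d.lffSystemU lam δs).δs k + ((d.lffSystemU lam δs).C *ᵥ RecastData.lffState δs x) k =
      relAngle x k.1.1 - relAngle x k.1.2 := by
  have hC : ((d.lffSystemU lam δs).C *ᵥ RecastData.lffState δs x) k =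
      (RecastData.lffEu n *ᵥ (RecastData.lffState δs x ∘ Sum.inl)) k := by
    rw [RecastData.lffSystemU, System.relativeSwing, System.secondOrder_C_mulVec]
  have hδ : (d.lffSystemU lam δs).δs k = δs k.1.1 - δs k.1.2 := rfl
  rw [hC, hδ, RecastData.lffEu_mulVec, RecastData.lffE_mulVec]
  have hcomp : RecastData.lffState δs x ∘ Sum.inl = fun m => RecastData.u δs x m.succ := funext fun _ => rfl
  have key (i : Fin (n + 1)) : Fin.cases (0 : ℝ) (fun m => RecastData.u δs x m.succ) i = RecastData.u δs x i :=
    Fin.cases (by simp) (fun _ => rfl) i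
  rw [hcomp, key, key]
  simp only [RecastData.u, relAngle]
  ring

/-- **`V_λ` on a machine state**: `½ yᵀQy − (2/λ+λ/2)·Σ_{i<j} C_ij (cos(a_i − a_j) + (a_i − a_j)·sd_ij)` with `y = lffState θ* x`
and the EXACT `sd_ij = sin(θ*_i − θ*_j)`. [cite: VuTuritsyn2016, §III eq. (Lyapunov)] -/
theorem certU_V_eq (lam : ℚ) (hlam : 0 < lam) {ν : ℝ} (hν : 0 < ν)
    (hM : ∀ i, 0 < d.M i) (hνM : ∀ m, ν < Mμ d m) (hCS : ∑ m, Mμ d m ^ 2 / (Mμ d m - ν) ≤ S d)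
    (hC : ∀ i j : Fin (n + 1), i ≠ j → 0 < d.Cc i j) (hE : d.EqData d.angleOf) (x : ClassicalSwing.State (n + 1)) :
    (certU d lam hlam d.angleOf hν hM hνM hCS hC).V (RecastData.lffState d.angleOf x) =
      1 / 2 * (RecastData.lffState d.angleOf x ⬝ᵥ
          ((certU d lam hlam d.angleOf hν hM hνM hCS hC).Q *ᵥ RecastData.lffState d.angleOf x)) -
        ∑ k : RecastData.LffLine n, (2 / (lam : ℝ) + (lam : ℝ) / 2) * (d.Cc k.1.1 k.1.2 : ℝ) *
          (Real.cos (relAngle x k.1.1 - relAngle x k.1.2) +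
            (relAngle x k.1.1 - relAngle x k.1.2) * (d.sd k.1.1 k.1.2 : ℝ)) := by
  unfold Certificate.V
  congr 1
  refine Finset.sum_congr rfl fun k _ => ?_
  have hl : (System.relativeSwing (Mμ d) (Mref d) (lam : ℝ) (RecastData.lffEu n) d.lffWu
        (RecastData.lffδsu d.angleOf)).δs k +
      ((System.relativeSwing (Mμ d) (Mref d) (lam : ℝ) (RecastData.lffEu n) d.lffWu
        (RecastData.lffδsu d.angleOf)).C *ᵥ RecastData.lffState d.angleOf x) k =
      relAngle x k.1.1 - relAngle x k.1.2 := lineAngle_lffState d lam d.angleOf x k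
  have hδ : (System.relativeSwing (Mμ d) (Mref d) (lam : ℝ) (RecastData.lffEu n) d.lffWu
      (RecastData.lffδsu d.angleOf)).δs k = d.angleOf k.1.1 - d.angleOf k.1.2 := rfl
  rw [hl, hδ, certU_kK, ← d.sd_cast hE]

/-! ### §3 A rational upper bound of a quadratic form on a box -/

section quad

variable {ι : Type*} [Fintype ι]

/-- Centre/radius bound of `zᵀAz` over the box `[zlo, zhi]` (any square matrix `A` over `ℚ`):
`cᵀAc + Σ_p (|(Ac)_p| + |(Aᵀc)_p|)·r_p + Σ_p Σ_q |A_pq|·r_p·r_q`, `c = (zlo+zhi)/2`, `r = (zhi−zlo)/2`. -/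
def quadBoxQ (A : ι → ι → ℚ) (zlo zhi : ι → ℚ) : ℚ :=
  (∑ p, (zlo p + zhi p) / 2 * ∑ q, A p q * ((zlo q + zhi q) / 2)) +
    (∑ p, (|∑ q, A p q * ((zlo q + zhi q) / 2)| + |∑ q, A q p * ((zlo q + zhi q) / 2)|) * ((zhi p - zlo p) / 2)) +
    ∑ p, ∑ q, |A p q| * ((zhi p - zlo p) / 2) * ((zhi q - zlo q) / 2)

/-- **`zᵀAz ≤ quadBoxQ A zlo zhi` on the box** (write `z = c + e`, `|e| ≤ r`, and bound the three error sums termwise).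
[folklore] -/
theorem quad_le_quadBoxQ (A : ι → ι → ℚ) (zlo zhi : ι → ℚ) (z : ι → ℝ)
    (hz : ∀ p, (zlo p : ℝ) ≤ z p ∧ z p ≤ (zhi p : ℝ)) :
    (∑ p, z p * ∑ q, ((A p q : ℚ) : ℝ) * z q) ≤ ((quadBoxQ A zlo zhi : ℚ) : ℝ) := by
  set c : ι → ℝ := fun p => ((zlo p : ℝ) + (zhi p : ℝ)) / 2 with hc
  set r : ι → ℝ := fun p => ((zhi p : ℝ) - (zlo p : ℝ)) / 2 with hr
  set e : ι → ℝ := fun p => z p - c p with he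
  have habs : ∀ p, |e p| ≤ r p := by
    intro p
    obtain ⟨h1, h2⟩ := hz p
    rw [abs_le]
    constructor <;> · simp only [he, hc, hr]; linarith
  have hr0 : ∀ p, 0 ≤ r p := fun p => (abs_nonneg _).trans (habs p)
  have hz' : ∀ p, z p = c p + e p := fun p => by simp [he]
  have expand : (∑ p, z p * ∑ q, ((A p q : ℚ) : ℝ) * z q) =
      (∑ p, c p * ∑ q, ((A p q : ℚ) : ℝ) * c q) + (∑ p, e p * ∑ q, ((A q p : ℚ) : ℝ) * c q) +
        (∑ p, e p * ∑ q, ((A p q : ℚ) : ℝ) * c q) + ∑ p, ∑ q, ((A p q : ℚ) : ℝ) * e p * e q := by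
    have h1 : (∑ p, z p * ∑ q, ((A p q : ℚ) : ℝ) * z q) =
        ∑ p, ∑ q, ((A p q : ℚ) : ℝ) * (c p + e p) * (c q + e q) := by
      refine Finset.sum_congr rfl fun p _ => ?_
      rw [hz' p, Finset.mul_sum]
      refine Finset.sum_congr rfl fun q _ => ?_
      rw [hz' q]; ring
    have h2 : (∑ p, e p * ∑ q, ((A q p : ℚ) : ℝ) * c q) = ∑ p, ∑ q, ((A p q : ℚ) : ℝ) * c p * e q := by
      rw [Finset.sum_comm]
      refine Finset.sum_congr rfl fun q _ => ?_
      rw [Finset.mul_sum]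
      refine Finset.sum_congr rfl fun p _ => ?_
      ring
    rw [h1, h2]
    simp only [Finset.mul_sum, ← Finset.sum_add_distrib]
    refine Finset.sum_congr rfl fun p _ => Finset.sum_congr rfl fun q _ => ?_
    ring
  rw [expand]
  have bnd : ∀ (p : ι) (t : ℝ), e p * t ≤ |t| * r p := fun p t =>
    calc e p * t ≤ |e p * t| := le_abs_self _
      _ = |e p| * |t| := abs_mul _ _
      _ ≤ r p * |t| := mul_le_mul_of_nonneg_right (habs p) (abs_nonneg _)
      _ = |t| * r p := mul_comm _ _
  have b1 : (∑ p, e p * ∑ q, ((A q p : ℚ) : ℝ) * c q) ≤ ∑ p, |∑ q, ((A q p : ℚ) : ℝ) * c q| * r p :=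
    Finset.sum_le_sum fun p _ => bnd p _
  have b2 : (∑ p, e p * ∑ q, ((A p q : ℚ) : ℝ) * c q) ≤ ∑ p, |∑ q, ((A p q : ℚ) : ℝ) * c q| * r p :=
    Finset.sum_le_sum fun p _ => bnd p _
  have b3 : (∑ p, ∑ q, ((A p q : ℚ) : ℝ) * e p * e q) ≤ ∑ p, ∑ q, |((A p q : ℚ) : ℝ)| * r p * r q := by
    refine Finset.sum_le_sum fun p _ => Finset.sum_le_sum fun q _ => ?_
    calc ((A p q : ℚ) : ℝ) * e p * e q ≤ |((A p q : ℚ) : ℝ) * e p * e q| := le_abs_self _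
      _ = |((A p q : ℚ) : ℝ)| * |e p| * |e q| := by rw [abs_mul, abs_mul]
      _ ≤ |((A p q : ℚ) : ℝ)| * r p * r q :=
          mul_le_mul (mul_le_mul_of_nonneg_left (habs p) (abs_nonneg _)) (habs q) (abs_nonneg _)
            (mul_nonneg (abs_nonneg _) (hr0 p))
  have hsum : ((quadBoxQ A zlo zhi : ℚ) : ℝ) =
      (∑ p, c p * ∑ q, ((A p q : ℚ) : ℝ) * c q) +
        (∑ p, (|∑ q, ((A p q : ℚ) : ℝ) * c q| + |∑ q, ((A q p : ℚ) : ℝ) * c q|) * r p) +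
        ∑ p, ∑ q, |((A p q : ℚ) : ℝ)| * r p * r q := by
    simp only [quadBoxQ, hc, hr]
    push_cast
    rfl
  rw [hsum]
  have hsplit : (∑ p, (|∑ q, ((A p q : ℚ) : ℝ) * c q| + |∑ q, ((A q p : ℚ) : ℝ) * c q|) * r p) =
      (∑ p, |∑ q, ((A q p : ℚ) : ℝ) * c q| * r p) + ∑ p, |∑ q, ((A p q : ℚ) : ℝ) * c q| * r p := by
    rw [← Finset.sum_add_distrib]; exact Finset.sum_congr rfl fun p _ => by ring
  linarith [b1, b2, b3]

end quad

/-! ### §4 The box test -/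

/-- Lower relative-angle corner of the box (`a_0 = 0` exactly). -/
def aLoQ (Sb : SwingTube.SliceBox (n + 1)) (i : Fin (n + 1)) : ℚ := if i = 0 then 0 else Sb.alo i

/-- Upper relative-angle corner of the box. -/
def aHiQ (Sb : SwingTube.SliceBox (n + 1)) (i : Fin (n + 1)) : ℚ := if i = 0 then 0 else Sb.ahi i

/-- Lower corner of the LFF state box `[u; ν]`: `u_m ∈ [alo_{m+1} − hi_{m+1} + lo_0, …]`, `ν_m ∈ [wlo_{m+1} − whi_0, …]`. -/
def zLoQ (lo hi : Fin (n + 1) → ℚ) (Sb : SwingTube.SliceBox (n + 1)) : Fin n ⊕ Fin n → ℚ :=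
  Sum.elim (fun m => aLoQ Sb m.succ - hi m.succ + lo 0) (fun m => Sb.wlo m.succ - Sb.whi 0)

/-- Upper corner of the LFF state box. -/
def zHiQ (lo hi : Fin (n + 1) → ℚ) (Sb : SwingTube.SliceBox (n + 1)) : Fin n ⊕ Fin n → ℚ :=
  Sum.elim (fun m => aHiQ Sb m.succ - lo m.succ + hi 0) (fun m => Sb.whi m.succ - Sb.wlo 0)

/-- Lower corner of the line angle `a_i − a_j`. -/
def dLoQ (Sb : SwingTube.SliceBox (n + 1)) (i j : Fin (n + 1)) : ℚ := aLoQ Sb i - aHiQ Sb j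

/-- Upper corner of the line angle `a_i − a_j`. -/
def dHiQ (Sb : SwingTube.SliceBox (n + 1)) (i j : Fin (n + 1)) : ℚ := aHiQ Sb i - aLoQ Sb j

/-- Rational UPPER bound of the potential part `−(2/λ+λ/2)·Σ_{i<j} C_ij (cos(a_i − a_j) + (a_i − a_j)·sd_ij)` on the box
(`cos ≥ cosRLo` on the line-angle interval, sign-free bound of the linear term). -/
def potHiQ (lam : ℚ) (Sb : SwingTube.SliceBox (n + 1)) : ℚ :=
  -∑ k : RecastData.LffLine n, (2 / lam + lam / 2) * d.Cc k.1.1 k.1.2 *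
      (SwingTube.cosRLo (dLoQ Sb k.1.1 k.1.2) (dHiQ Sb k.1.1 k.1.2) +
        min (dLoQ Sb k.1.1 k.1.2 * d.sd k.1.1 k.1.2) (dHiQ Sb k.1.1 k.1.2 * d.sd k.1.1 k.1.2))

/-- **THE RATIONAL UPPER BOUND OF `V_λ` ON THE BOX.** -/
def VhiQ (lam : ℚ) (lo hi : Fin (n + 1) → ℚ) (Sb : SwingTube.SliceBox (n + 1)) : ℚ :=
  quadBoxQ (QblkQ d lam) (zLoQ lo hi Sb) (zHiQ lo hi Sb) / 2 + potHiQ d lam Sb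

/-- Admissibility of the box for the trig enclosures: every line-angle interval inside `[−3, 3]`. -/
def boxOKQ (Sb : SwingTube.SliceBox (n + 1)) : Bool :=
  decide (∀ i j : Fin (n + 1), i < j → -3 ≤ dLoQ Sb i j ∧ dHiQ Sb i j ≤ 3)

/-- Polytope test: `max(|dlo|, |dhi|) + lineHi_ij < 3.1415` on every line. -/
def polyOKQ (lo hi : Fin (n + 1) → ℚ) (Sb : SwingTube.SliceBox (n + 1)) : Bool :=
  decide (∀ i j : Fin (n + 1), i < j →
    max (|dLoQ Sb i j|) (|dHiQ Sb i j|) + lineHi lo hi i j < 31415 / 10000)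

/-- Relative angles of a state in the box lie in `[aLoQ, aHiQ]`. -/
theorem relAngle_mem {Sb : SwingTube.SliceBox (n + 1)} {x : ClassicalSwing.State (n + 1)} (hx : x ∈ Sb.toSet)
    (i : Fin (n + 1)) : ((aLoQ Sb i : ℚ) : ℝ) ≤ relAngle x i ∧ relAngle x i ≤ ((aHiQ Sb i : ℚ) : ℝ) := by
  by_cases h : i = 0
  · subst h; simp [aLoQ, aHiQ, relAngle]
  · rw [SwingTube.SliceBox.mem_toSet] at hx
    obtain ⟨h1, h2, -, -⟩ := hx i
    simp only [aLoQ, aHiQ, h, if_false, relAngle]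
    exact ⟨h1, h2⟩

/-- Line angles of a state in the box lie in `[dLoQ, dHiQ]`. -/
theorem lineAngle_mem {Sb : SwingTube.SliceBox (n + 1)} {x : ClassicalSwing.State (n + 1)} (hx : x ∈ Sb.toSet)
    (i j : Fin (n + 1)) :
    ((dLoQ Sb i j : ℚ) : ℝ) ≤ relAngle x i - relAngle x j ∧ relAngle x i - relAngle x j ≤ ((dHiQ Sb i j : ℚ) : ℝ) := by
  have hi := relAngle_mem hx i
  have hj := relAngle_mem hx j
  simp only [dLoQ, dHiQ]
  push_cast
  exact ⟨by linarith [hi.1, hj.2], by linarith [hi.2, hj.1]⟩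

/-- The LFF state of a state in the box lies in `[zLoQ, zHiQ]` (node tables `lo ≤ θ* ≤ hi`). -/
theorem lffState_mem {lo hi : Fin (n + 1) → ℚ} (hlo : ∀ i, (lo i : ℝ) ≤ d.angleOf i) (hhi : ∀ i, d.angleOf i ≤ (hi i : ℝ))
    {Sb : SwingTube.SliceBox (n + 1)} {x : ClassicalSwing.State (n + 1)} (hx : x ∈ Sb.toSet) (p : Fin n ⊕ Fin n) :
    ((zLoQ lo hi Sb p : ℚ) : ℝ) ≤ RecastData.lffState d.angleOf x p ∧
      RecastData.lffState d.angleOf x p ≤ ((zHiQ lo hi Sb p : ℚ) : ℝ) := by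
  rcases p with m | m
  · have ha := relAngle_mem hx m.succ
    have h1 := hlo m.succ; have h2 := hhi m.succ; have h3 := hlo 0; have h4 := hhi 0
    simp only [zLoQ, zHiQ, Sum.elim_inl, RecastData.lffState, RecastData.u]
    simp only [relAngle] at ha
    push_cast
    exact ⟨by linarith [ha.1], by linarith [ha.2]⟩
  · rw [SwingTube.SliceBox.mem_toSet] at hx
    obtain ⟨-, -, w1, w2⟩ := hx m.succ
    obtain ⟨-, -, w3, w4⟩ := hx 0
    simp only [zLoQ, zHiQ, Sum.elim_inr, RecastData.lffState]
    push_cast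
    exact ⟨by linarith, by linarith⟩

/-- One line of the potential part: the rational enclosure is below the true term on the box. -/
theorem potLine_le (lam : ℚ) (hlam : 0 < lam) (hC : ∀ i j : Fin (n + 1), i ≠ j → 0 < d.Cc i j)
    {Sb : SwingTube.SliceBox (n + 1)} (hok : boxOKQ Sb = true) {x : ClassicalSwing.State (n + 1)} (hx : x ∈ Sb.toSet)
    (k : RecastData.LffLine n) :
    (2 / (lam : ℝ) + (lam : ℝ) / 2) * (d.Cc k.1.1 k.1.2 : ℝ) *
        (((SwingTube.cosRLo (dLoQ Sb k.1.1 k.1.2) (dHiQ Sb k.1.1 k.1.2) : ℚ) : ℝ) +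
          ((min (dLoQ Sb k.1.1 k.1.2 * d.sd k.1.1 k.1.2) (dHiQ Sb k.1.1 k.1.2 * d.sd k.1.1 k.1.2) : ℚ) : ℝ)) ≤
      (2 / (lam : ℝ) + (lam : ℝ) / 2) * (d.Cc k.1.1 k.1.2 : ℝ) *
        (Real.cos (relAngle x k.1.1 - relAngle x k.1.2) +
          (relAngle x k.1.1 - relAngle x k.1.2) * (d.sd k.1.1 k.1.2 : ℝ)) := by
  simp only [boxOKQ, decide_eq_true_eq] at hok
  have hlam' : (0 : ℝ) < lam := by exact_mod_cast hlam
  have hc' : (0 : ℝ) < 2 / (lam : ℝ) + (lam : ℝ) / 2 := by positivity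
  obtain ⟨h3l, h3u⟩ := hok k.1.1 k.1.2 k.2
  obtain ⟨hd1, hd2⟩ := lineAngle_mem hx k.1.1 k.1.2
  have hcos := SwingTube.cosRLo_le h3l h3u hd1 hd2
  have hlin := (SwingTube.mul_mem_minmax ((d.sd k.1.1 k.1.2 : ℚ) : ℝ) hd1 hd2).1
  have hCk : (0 : ℝ) ≤ (d.Cc k.1.1 k.1.2 : ℝ) := by exact_mod_cast (hC k.1.1 k.1.2 (ne_of_lt k.2)).le
  have hfac : (0 : ℝ) ≤ (2 / (lam : ℝ) + (lam : ℝ) / 2) * (d.Cc k.1.1 k.1.2 : ℝ) := mul_nonneg hc'.le hCk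
  have hmin : ((min (dLoQ Sb k.1.1 k.1.2 * d.sd k.1.1 k.1.2) (dHiQ Sb k.1.1 k.1.2 * d.sd k.1.1 k.1.2) : ℚ) : ℝ) ≤
      (relAngle x k.1.1 - relAngle x k.1.2) * (d.sd k.1.1 k.1.2 : ℝ) := by
    rw [Rat.cast_min, Rat.cast_mul, Rat.cast_mul, mul_comm ((dLoQ Sb k.1.1 k.1.2 : ℚ) : ℝ),
      mul_comm ((dHiQ Sb k.1.1 k.1.2 : ℚ) : ℝ), mul_comm (relAngle x k.1.1 - relAngle x k.1.2)]
    exact hlin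
  exact mul_le_mul_of_nonneg_left (add_le_add hcos hmin) hfac

/-- The cast of `potHiQ`, term by term. -/
theorem potHiQ_cast (lam : ℚ) (Sb : SwingTube.SliceBox (n + 1)) :
    ((potHiQ d lam Sb : ℚ) : ℝ) = -∑ k : RecastData.LffLine n, (2 / (lam : ℝ) + (lam : ℝ) / 2) * (d.Cc k.1.1 k.1.2 : ℝ) *
        (((SwingTube.cosRLo (dLoQ Sb k.1.1 k.1.2) (dHiQ Sb k.1.1 k.1.2) : ℚ) : ℝ) +
          ((min (dLoQ Sb k.1.1 k.1.2 * d.sd k.1.1 k.1.2) (dHiQ Sb k.1.1 k.1.2 * d.sd k.1.1 k.1.2) : ℚ) : ℝ)) := by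
  simp only [potHiQ, Rat.cast_neg, Rat.cast_sum, Rat.cast_mul, Rat.cast_add, Rat.cast_div, Rat.cast_ofNat]

/-- **SOUNDNESS OF THE BOX TEST: `V_λ ≤ VhiQ` on the box.** [cite: VuTuritsyn2016, §III eq. (Lyapunov)] -/
theorem certU_V_le_VhiQ (lam : ℚ) (hlam : 0 < lam) {ν : ℝ} (hν : 0 < ν)
    (hM : ∀ i, 0 < d.M i) (hνM : ∀ m, ν < Mμ d m) (hCS : ∑ m, Mμ d m ^ 2 / (Mμ d m - ν) ≤ S d)
    (hC : ∀ i j : Fin (n + 1), i ≠ j → 0 < d.Cc i j) (hE : d.EqData d.angleOf)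
    {lo hi : Fin (n + 1) → ℚ} (hlo : ∀ i, (lo i : ℝ) ≤ d.angleOf i) (hhi : ∀ i, d.angleOf i ≤ (hi i : ℝ))
    {Sb : SwingTube.SliceBox (n + 1)} (hok : boxOKQ Sb = true) {x : ClassicalSwing.State (n + 1)} (hx : x ∈ Sb.toSet) :
    (certU d lam hlam d.angleOf hν hM hνM hCS hC).V (RecastData.lffState d.angleOf x) ≤
      ((VhiQ d lam lo hi Sb : ℚ) : ℝ) := by
  rw [certU_V_eq d lam hlam hν hM hνM hCS hC hE x]
  have hquad : RecastData.lffState d.angleOf x ⬝ᵥ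
      ((certU d lam hlam d.angleOf hν hM hνM hCS hC).Q *ᵥ RecastData.lffState d.angleOf x) ≤
      ((quadBoxQ (QblkQ d lam) (zLoQ lo hi Sb) (zHiQ lo hi Sb) : ℚ) : ℝ) := by
    have h := quad_le_quadBoxQ (QblkQ d lam) (zLoQ lo hi Sb) (zHiQ lo hi Sb) (RecastData.lffState d.angleOf x)
      (lffState_mem d hlo hhi hx)
    have e : RecastData.lffState d.angleOf x ⬝ᵥ
        ((certU d lam hlam d.angleOf hν hM hνM hCS hC).Q *ᵥ RecastData.lffState d.angleOf x) =
        ∑ p, RecastData.lffState d.angleOf x p * ∑ q, ((QblkQ d lam p q : ℚ) : ℝ) * RecastData.lffState d.angleOf x q := by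
      simp only [dotProduct, Matrix.mulVec, certU_Q_cast]
    rw [e]; exact h
  have hpot := Finset.sum_le_sum fun k (_ : k ∈ (Finset.univ : Finset (RecastData.LffLine n))) =>
    potLine_le d lam hlam hC hok hx k
  have hV : ((VhiQ d lam lo hi Sb : ℚ) : ℝ) =
      ((quadBoxQ (QblkQ d lam) (zLoQ lo hi Sb) (zHiQ lo hi Sb) : ℚ) : ℝ) / 2 + ((potHiQ d lam Sb : ℚ) : ℝ) := by
    simp only [VhiQ, Rat.cast_add, Rat.cast_div, Rat.cast_ofNat]
  rw [hV, potHiQ_cast]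
  linarith [hquad, hpot]

/-- **SOUNDNESS OF THE POLYTOPE TEST**: `polyOKQ` ⇒ the LFF state of every state in the box lies in the Vu–Turitsyn polytope
`𝒫 = {|(a_i − a_j) + (θ*_i − θ*_j)| < π}`. [cite: VuTuritsyn2016, §IV set ℛ] -/
theorem lffState_mem_polytope_of_polyOKQ (lam : ℚ) {lo hi : Fin (n + 1) → ℚ}
    (hlo : ∀ i, (lo i : ℝ) ≤ d.angleOf i) (hhi : ∀ i, d.angleOf i ≤ (hi i : ℝ))
    {Sb : SwingTube.SliceBox (n + 1)} (hP : polyOKQ lo hi Sb = true) {x : ClassicalSwing.State (n + 1)}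
    (hx : x ∈ Sb.toSet) :
    RecastData.lffState d.angleOf x ∈ (d.lffSystemU lam d.angleOf).polytope := by
  simp only [polyOKQ, decide_eq_true_eq] at hP
  intro k
  rw [lineAngle_lffState d lam d.angleOf x k]
  have hδ : (d.lffSystemU lam d.angleOf).δs k = d.angleOf k.1.1 - d.angleOf k.1.2 := rfl
  rw [hδ]
  obtain ⟨hd1, hd2⟩ := lineAngle_mem hx k.1.1 k.1.2
  set mLo : ℝ := ((dLoQ Sb k.1.1 k.1.2 : ℚ) : ℝ) with hmLo
  set mHi : ℝ := ((dHiQ Sb k.1.1 k.1.2 : ℚ) : ℝ) with hmHi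
  have h1 : |relAngle x k.1.1 - relAngle x k.1.2| ≤ max (|mLo|) (|mHi|) := by
    rw [abs_le]
    constructor
    · have e1 : -(|mLo|) ≤ mLo := neg_abs_le _
      have e2 : |mLo| ≤ max (|mLo|) (|mHi|) := le_max_left _ _
      linarith
    · exact le_trans hd2 ((le_abs_self _).trans (le_max_right _ _))
  have h2 := abs_sub_le_lineHi hlo hhi k.1.1 k.1.2
  have h3 := (Rat.cast_lt (K := ℝ)).mpr (hP k.1.1 k.1.2 k.2)
  have h3' : max (|mLo|) (|mHi|) + ((lineHi lo hi k.1.1 k.1.2 : ℚ) : ℝ) < 31415 / 10000 := by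
    have e : (((max (|dLoQ Sb k.1.1 k.1.2|) (|dHiQ Sb k.1.1 k.1.2|) + lineHi lo hi k.1.1 k.1.2 : ℚ)) : ℝ) =
        max (|mLo|) (|mHi|) + ((lineHi lo hi k.1.1 k.1.2 : ℚ) : ℝ) := by
      push_cast [hmLo, hmHi]; rfl
    rw [e] at h3
    have e2 : (((31415 / 10000 : ℚ)) : ℝ) = 31415 / 10000 := by norm_num
    rw [e2] at h3
    exact h3
  calc |relAngle x k.1.1 - relAngle x k.1.2 + (d.angleOf k.1.1 - d.angleOf k.1.2)|
      ≤ |relAngle x k.1.1 - relAngle x k.1.2| + |d.angleOf k.1.1 - d.angleOf k.1.2| := abs_add_le _ _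
    _ < 31415 / 10000 := by linarith
    _ ≤ π := pi_ge_31415

end Summit.Ventures.GridStability.Lyapunov.RelativeLff

end
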